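import Summits.RiemannHypothesis.RiemannHypothesis.Theorems.PfPersistencePerronFakeNodeless
import Summits.RiemannHypothesis.RiemannHypothesis.Theorems.PfPersistencePerronFakeNodelessEvenKernel
import HarnessLib

/-!
# PF persistence — PERRON-FAKE (S6), part 5b: the EVEN-SECTOR named hypothesis PROVED on the
# window `0 < a ≤ 11/40` (every real table, every even-sector ground state)

`pub-rhpf` cell, unit `pub-rhpf-prover-perron` (S6; CASE-DAG §6 row PERRON-FAKE; leaves G1.01 / G1.02,
FAKE column).  **Mechanism / rigidity campaign; no RH claims.**  RH-free, definition-free: Mathlib +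
proved tree files only.

Part 4 proved the parity-free sign theorem on `(0, 1/8]` from the INTEGRATED lobe-balance law with the
kernel inequality `2cosh a < ρ(2a)` (`ρ = weilArchDensity`).  In the EVEN sector both sides of the
balance improve, and it decides the sign on a window more than twice as large:

* polar side — for even `u` the repulsion is the single rank-one channel `cosh(·/2)` (part 2,
  `integral_posPart_mul_cosh_of_even`): against `u⁻` it is at most `(1 + cosh a)·(∫u⁺)·u⁻`
  (`2cosh(y/2)cosh(x/2) ≤ 2cosh²(a/2) = 1 + cosh a`), not `2cosh a`;
* archimedean side — for even `u` the attraction comes through the symmetrised kernel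
  `½(ρ|x−y| + ρ|x+y|) ≥ ρ(a)` (part 5a, `archPairing_ge_of_even`), not `ρ(2a)`.

Results (namespace `…Theorems.PfPersistence`):

* `aeOneSigned_of_evenFold_le_of_evenKernel` (PROVED): at a window with `2a < log 2` and
  **`1 + cosh a < ρ(a)`**, every real EVEN `u` of the finite-energy class `coreAdm a` that folding
  does not lower (`Q^w_a(u) ≤ Q^w_a(|u|)`, ANY real table `w`) is a.e. one-signed:
  lobe balance (part 1) `∫u⁻S^w_u ≤ 0`, the atomic part vanishes against `u⁻` (no prime length in the
  window), polar `≤ (1 + cosh a)(∫u⁺)(∫u⁻)`, archimedean `≥ ρ(a)(∫u⁺)(∫u⁻)`, hence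
  `(ρ(a) − 1 − cosh a)(∫u⁺)(∫u⁻) ≤ 0`.
* `aeOneSigned_of_evenFold_le_evenWindow`, `aeOneSigned_of_evenMinimal_evenWindow` (PROVED, with the
  numerics `one_add_cosh_lt_weilArchDensity_of_le` of part 5a): for `0 < a ≤ 11/40`, every real even
  member of the class not lowered by folding — in particular every real even-sector ground state of
  the FULL closed form `tableClosedForm a w` of ANY real table — is a.e. one-signed (nodal count `0`).
* `allEvenGroundStatesOneSigned_evenWindow`, `perronSourceDominatedEven_evenWindow` (PROVED): the
  typed even-sector inputs of part 3 are THEOREMS on `(0, 11/40]` for every real table (parts 3/4: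
  `(0, 1/8]`, parity-free).

Scope (honest): `11/40 < log 2 / 2`, so no table acts yet (the window sees no prime length) — this is
a theorem about the archimedean + polar form shared by every table, in the even sector, still below
the cell's served windows, and the true threshold of the method is `a = 0.2782…`.  It is table-blind:
the first windows containing a prime length (`a > log 2/2`) need the table's `p = 2` weight in the
balance and are NOT treated here.  The parity-free window `(0, 1/8]` of part 4 is not improved.

References (mechanism only; no RH content): P. Jentzsch, J. reine angew. Math. 141 (1912) 235–244
(positive kernels: positive simple principal eigenfunction); M. Reed, B. Simon, *Methods of Modern
Mathematical Physics IV* (1978) §XIII.12, Thms XIII.43–44 (Perron–Frobenius / nodeless ground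
states); E. Bombieri, Rend. Mat. Acc. Lincei (9) 11 (2000) 183–233, Thm 2 (the windowed form).
-/

set_option linter.dupNamespace false

noncomputable section

open MeasureTheory Set Filter Complex
open scoped Real Topology

namespace Summit.RiemannHypothesis.RiemannHypothesis.Theorems.PfPersistence

open Literature.NumberTheory.LFunctions
open Summit.RiemannHypothesis.RiemannHypothesis.Theorems.WeilGroundStateMarkovPart
open Summit.RiemannHypothesis.RiemannHypothesis.Theorems.PolarPerronFrobenius

section EvenWindow

variable {a : ℝ} {u : ℝ → ℝ}

/-- **Even-sector sign theorem (PROVED).**  At a window with `2a < log 2` and `1 + cosh a < ρ(a)`,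
a real EVEN member of the finite-energy class that folding does not lower is a.e. one-signed — for
every real table `w`. [folklore] -/
theorem aeOneSigned_of_evenFold_le_of_evenKernel (w : ℕ → ℝ) (hum : Measurable u)
    (hU : coreAdm a (fun x ↦ ((u x : ℝ) : ℂ))) (he : ∀ x, u (-x) = u x) (ha0 : 0 < a)
    (h2a : 2 * a < Real.log 2) (hker : 1 + Real.cosh a < weilArchDensity a)
    (hfold : tableClosedForm a w (fun x ↦ ((u x : ℝ) : ℂ)) ≤
      tableClosedForm a w (fun x ↦ ((|u x| : ℝ) : ℂ))) :
    (∀ᵐ y : ℝ, 0 ≤ u y) ∨ (∀ᵐ y : ℝ, u y ≤ 0) := by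
  set U : ℝ → ℂ := fun x ↦ ((u x : ℝ) : ℂ) with hUdef
  set A : ℝ → ℂ := fun x ↦ ((|u x| : ℝ) : ℂ) with hAdef
  have hU2 : MemLp U 2 volume := hU.1
  have hu2 : MemLp u 2 volume :=
    MemLp.of_le hU2 hum.aestronglyMeasurable (Eventually.of_forall fun x ↦ by simp [hUdef])
  have hus' : ∀ x : ℝ, x ∉ Icc (-a) a → u x = 0 := fun x hx ↦ by
    have h := hU.2.1 x hx
    simpa [hUdef] using h
  have hus : ∀ᵐ x : ℝ, x ∉ Icc (-a) a → u x = 0 := Eventually.of_forall hus'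
  have hp2 := swg_memLp_posPart hu2
  have hn2 := swg_memLp_negPart hu2
  have hp1 : Integrable fun x ↦ max (u x) 0 := swg_integrable_of_memLp hp2 (swg_posPart_ae_zero hus)
  have hn1 : Integrable fun x ↦ max (-u x) 0 := swg_integrable_of_memLp hn2 (swg_negPart_ae_zero hus)
  have hE : IntegrableOn (fun t ↦ weilArchDensity t * weilIncrement U t) (Ioi 0) := hU.2.2
  have hAeq : (fun x ↦ ((‖U x‖ : ℝ) : ℂ)) = A := by
    funext x; simp [hUdef, hAdef]
  have hEA : IntegrableOn (fun t ↦ weilArchDensity t * weilIncrement A t) (Ioi 0) := by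
    have h := finiteEnergy_norm hU2 hE
    rwa [hAeq] at h
  obtain ⟨-, hIJ⟩ := swg_archGain_eq hum hu2 hE hEA
  -- the two masses
  have hmp0 : 0 ≤ ∫ x, max (u x) 0 := integral_nonneg fun x ↦ le_max_right _ _
  have hmn0 : 0 ≤ ∫ x, max (-u x) 0 := integral_nonneg fun x ↦ le_max_right _ _
  -- (1) lobe balance: `∫ u⁻ S ≤ 0`
  obtain ⟨hid, hIS⟩ := tableClosedForm_abs_sub_eq_source w hum hU
    (fun y ↦ (∫ t in Ioi (0 : ℝ), weilArchDensity t * (max (u (y + t)) 0 + max (u (y - t)) 0)) +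
      (∑ n ∈ weilPrimeIndex a, w n * (max (u (y + Real.log n)) 0 + max (u (y - Real.log n)) 0)) -
      2 * ∫ x, max (u x) 0 * Real.cosh ((x - y) / 2)) (fun y ↦ rfl)
  have hS0 : ∫ y, max (-u y) 0 *
      ((∫ t in Ioi (0 : ℝ), weilArchDensity t * (max (u (y + t)) 0 + max (u (y - t)) 0)) +
        (∑ n ∈ weilPrimeIndex a, w n * (max (u (y + Real.log n)) 0 + max (u (y - Real.log n)) 0)) -
        2 * ∫ x, max (u x) 0 * Real.cosh ((x - y) / 2)) ≤ 0 := by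
    have h0 : 0 ≤ tableClosedForm a w A - tableClosedForm a w U := sub_nonneg.2 hfold
    rw [hid] at h0
    linarith
  -- (2) the atomic part vanishes against `u⁻` (no prime length enters the window)
  have hlog0 : ∀ n ∈ weilPrimeIndex a, Real.log (n : ℝ) = 0 := by
    intro n hn
    have hlt : Real.log (n : ℝ) < Real.log 2 := (mem_weilPrimeIndex.1 hn).trans h2a
    have hn2 : n < 2 := by
      by_contra h
      push Not at h
      have h' : (2 : ℝ) ≤ n := by exact_mod_cast h
      have : Real.log 2 ≤ Real.log (n : ℝ) := Real.log_le_log (by norm_num) h'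
      linarith
    interval_cases n <;> simp
  have hP0 : ∀ y, max (-u y) 0 *
      (∑ n ∈ weilPrimeIndex a, w n * (max (u (y + Real.log n)) 0 + max (u (y - Real.log n)) 0)) =
        0 := by
    intro y
    have hpm : max (-u y) 0 * max (u y) 0 = 0 := by
      rcases le_total 0 (u y) with h | h
      · rw [max_eq_right (by linarith : -u y ≤ 0), zero_mul]
      · rw [max_eq_right h, mul_zero]
    rw [Finset.mul_sum]
    refine Finset.sum_eq_zero fun n hn ↦ ?_
    rw [hlog0 n hn, add_zero, sub_zero]
    calc max (-u y) 0 * (w n * (max (u y) 0 + max (u y) 0))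
        = 2 * w n * (max (-u y) 0 * max (u y) 0) := by ring
      _ = 0 := by rw [hpm, mul_zero]
  -- (3) EVEN polar channel: the polar part against `u⁻` is at most `(1 + cosh a)·m₊·u⁻`
  have hcosh2 : Continuous fun x : ℝ ↦ Real.cosh (x / 2) :=
    Real.continuous_cosh.comp (continuous_id.div_const 2)
  have hC0 : 0 ≤ ∫ x, max (u x) 0 * Real.cosh (x / 2) :=
    integral_nonneg fun x ↦ mul_nonneg (le_max_right _ _) (Real.cosh_pos _).le
  have hCle : ∫ x, max (u x) 0 * Real.cosh (x / 2) ≤ Real.cosh (a / 2) * ∫ x, max (u x) 0 := by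
    rw [show Real.cosh (a / 2) * ∫ x, max (u x) 0 = ∫ x, max (u x) 0 * Real.cosh (a / 2) by
      rw [integral_mul_const]; ring]
    refine integral_mono (swg_integrable_mul_continuous hp1 (swg_posPart_ae_zero hus) hcosh2)
      (hp1.mul_const _) fun x ↦ ?_
    by_cases hx : x ∈ Icc (-a) a
    · refine mul_le_mul_of_nonneg_left ?_ (le_max_right _ _)
      rw [Real.cosh_le_cosh, abs_of_nonneg (by linarith : 0 ≤ a / 2), abs_le]
      constructor <;> linarith [hx.1, hx.2]
    · simp only [hus' x hx, max_self, zero_mul, le_refl]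
  have hsq : 2 * Real.cosh (a / 2) ^ 2 = 1 + Real.cosh a := by
    rw [swe_two_mul_cosh_sq, show 2 * (a / 2) = a by ring]
  have hRle : ∀ y, max (-u y) 0 * (2 * ∫ x, max (u x) 0 * Real.cosh ((x - y) / 2)) ≤
      max (-u y) 0 * ((1 + Real.cosh a) * ∫ x, max (u x) 0) := by
    intro y
    by_cases hy : y ∈ Icc (-a) a
    · refine mul_le_mul_of_nonneg_left ?_ (le_max_right _ _)
      rw [integral_posPart_mul_cosh_of_even hu2 hus he y]
      have hcy : Real.cosh (y / 2) ≤ Real.cosh (a / 2) := by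
        rw [Real.cosh_le_cosh, abs_of_nonneg (by linarith : 0 ≤ a / 2), abs_le]
        constructor <;> linarith [hy.1, hy.2]
      have h4 := mul_le_mul hcy hCle hC0 (Real.cosh_pos _).le
      calc 2 * (Real.cosh (y / 2) * ∫ x, max (u x) 0 * Real.cosh (x / 2))
          ≤ 2 * (Real.cosh (a / 2) * (Real.cosh (a / 2) * ∫ x, max (u x) 0)) := by linarith
        _ = (1 + Real.cosh a) * ∫ x, max (u x) 0 := by rw [← hsq]; ring
    · simp only [hus' y hy, neg_zero, max_self, zero_mul, le_refl]
  -- (4) EVEN archimedean channel (part 5a): at least `ρ(a)·m₊·m₋`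
  have hAge : weilArchDensity a * ((∫ x, max (u x) 0) * ∫ x, max (-u x) 0) ≤
      ∫ y, max (-u y) 0 *
        ∫ t in Ioi (0 : ℝ), weilArchDensity t * (max (u (y + t)) 0 + max (u (y - t)) 0) :=
    archPairing_ge_of_even hum hu2 hus' he ha0 hE hEA
  -- (5) assemble: `(ρ(a) − 1 − cosh a)·m₊·m₋ ≤ 0`
  have hcomb : ∫ y, (max (-u y) 0 *
      (∫ t in Ioi (0 : ℝ), weilArchDensity t * (max (u (y + t)) 0 + max (u (y - t)) 0)) -
        max (-u y) 0 * ((1 + Real.cosh a) * ∫ x, max (u x) 0)) ≤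
      ∫ y, max (-u y) 0 *
        ((∫ t in Ioi (0 : ℝ), weilArchDensity t * (max (u (y + t)) 0 + max (u (y - t)) 0)) +
          (∑ n ∈ weilPrimeIndex a, w n * (max (u (y + Real.log n)) 0 + max (u (y - Real.log n)) 0)) -
          2 * ∫ x, max (u x) 0 * Real.cosh ((x - y) / 2)) := by
    refine integral_mono (hIJ.sub (hn1.mul_const _)) hIS fun y ↦ ?_
    have h1 := hP0 y
    have h2 := hRle y
    simp only
    rw [mul_sub, mul_add, h1, add_zero]
    linarith
  rw [integral_sub hIJ (hn1.mul_const _), integral_mul_const] at hcomb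
  have hprod : (weilArchDensity a - (1 + Real.cosh a)) *
      ((∫ x, max (u x) 0) * ∫ x, max (-u x) 0) ≤ 0 := by
    nlinarith [hAge, hcomb, hS0]
  have hgap : 0 < weilArchDensity a - (1 + Real.cosh a) := sub_pos.2 hker
  have hmm : (∫ x, max (u x) 0) * ∫ x, max (-u x) 0 ≤ 0 := by
    by_contra h
    push Not at h
    nlinarith
  have hz : (∫ x, max (u x) 0) = 0 ∨ (∫ x, max (-u x) 0) = 0 := by
    by_contra h
    push Not at h
    have h1 : 0 < ∫ x, max (u x) 0 := lt_of_le_of_ne hmp0 (Ne.symm h.1)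
    have h2 : 0 < ∫ x, max (-u x) 0 := lt_of_le_of_ne hmn0 (Ne.symm h.2)
    nlinarith [mul_pos h1 h2]
  rcases hz with h | h
  · right
    have h' := (integral_eq_zero_iff_of_nonneg (fun x ↦ le_max_right _ _) hp1).1 h
    filter_upwards [h'] with x hx
    have hx' : max (u x) 0 = 0 := hx
    exact max_eq_right_iff.1 hx'
  · left
    have h' := (integral_eq_zero_iff_of_nonneg (fun x ↦ le_max_right _ _) hn1).1 h
    filter_upwards [h'] with x hx
    have hx' : max (-u x) 0 = 0 := hx
    have := max_eq_right_iff.1 hx'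
    linarith

/-! ### Corollaries at `0 < a ≤ 11/40` -/

/-- **Even window (PROVED)**: for `0 < a ≤ 11/40` and every real table, a real EVEN member of the
finite-energy class that folding does not lower is a.e. one-signed. [folklore] -/
theorem aeOneSigned_of_evenFold_le_evenWindow (w : ℕ → ℝ) (hum : Measurable u)
    (hU : coreAdm a (fun x ↦ ((u x : ℝ) : ℂ))) (he : ∀ x, u (-x) = u x) (ha0 : 0 < a)
    (ha : a ≤ 11 / 40)
    (hfold : tableClosedForm a w (fun x ↦ ((u x : ℝ) : ℂ)) ≤
      tableClosedForm a w (fun x ↦ ((|u x| : ℝ) : ℂ))) :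
    (∀ᵐ y : ℝ, 0 ≤ u y) ∨ (∀ᵐ y : ℝ, u y ≤ 0) :=
  aeOneSigned_of_evenFold_le_of_evenKernel w hum hU he ha0 (two_mul_lt_log_two_of_le_evenWindow ha)
    (one_add_cosh_lt_weilArchDensity_of_le ha0 ha) hfold

/-- Rewriting `‖·‖` of a real-valued function as `|·|` inside the fold inequality. [folklore] -/
private theorem fold_real_ew {w : ℕ → ℝ} {V : ℝ → ℝ}
    (h : tableClosedForm a w (fun x ↦ ((V x : ℝ) : ℂ)) ≤
      tableClosedForm a w (fun x ↦ ((‖((V x : ℝ) : ℂ)‖ : ℝ) : ℂ))) :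
    tableClosedForm a w (fun x ↦ ((V x : ℝ) : ℂ)) ≤ tableClosedForm a w (fun x ↦ ((|V x| : ℝ) : ℂ)) := by
  have e : (fun x ↦ ((‖((V x : ℝ) : ℂ)‖ : ℝ) : ℂ)) = fun x ↦ ((|V x| : ℝ) : ℂ) := by funext x; simp
  rwa [e] at h

/-- **Every real even-sector ground state of the full closed form of ANY real table at a window
`0 < a ≤ 11/40` is a.e. one-signed (PROVED; nodal count `0`).** [folklore] -/
theorem aeOneSigned_of_evenMinimal_evenWindow (w : ℕ → ℝ) (hum : Measurable u)
    (hU : coreAdm a (fun x ↦ ((u x : ℝ) : ℂ))) (ha0 : 0 < a) (ha : a ≤ 11 / 40)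
    (he : ∀ x, u (-x) = u x) (hN : ∫ x, ‖((u x : ℝ) : ℂ)‖ ^ 2 = (1 : ℝ))
    (hmin : ∀ v : ℝ → ℂ, coreAdm a v → (∀ x, v (-x) = v x) →
      tableClosedForm a w (fun x ↦ ((u x : ℝ) : ℂ)) * (∫ x, ‖v x‖ ^ 2) ≤ tableClosedForm a w v) :
    (∀ᵐ y : ℝ, 0 ≤ u y) ∨ (∀ᵐ y : ℝ, u y ≤ 0) :=
  aeOneSigned_of_evenFold_le_evenWindow w hum hU he ha0 ha
    (fold_real_ew (fold_le_of_evenMinimal hU (fun x ↦ by simp [he x]) hN hmin))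

end EvenWindow

/-! ### The typed even-sector inputs of part 3, PROVED on `(0, 11/40]` -/

section EvenWindowNamed

variable {a : ℝ} {w : ℕ → ℝ}

/-- **`AllEvenGroundStatesOneSigned a w` for `0 < a ≤ 11/40` and every real table (PROVED).**
[folklore] -/
theorem allEvenGroundStatesOneSigned_evenWindow (ha0 : 0 < a) (ha : a ≤ 11 / 40) :
    AllEvenGroundStatesOneSigned a w := fun _ hum hG ↦
  aeOneSigned_of_evenMinimal_evenWindow w hum hG.1 ha0 ha
    (fun x ↦ by have h := hG.2.1 x; simp only at h; exact_mod_cast h) hG.2.2.1 hG.2.2.2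

/-- **The even-sector domination hypothesis is a THEOREM on `0 < a ≤ 11/40` (every real table).**
[folklore] -/
theorem perronSourceDominatedEven_evenWindow (ha0 : 0 < a) (ha : a ≤ 11 / 40) :
    PerronSourceDominatedEven a w :=
  perronSourceDominatedEven_iff.2 (allEvenGroundStatesOneSigned_evenWindow ha0 ha)

/-- The parity-free window `(0, 1/8]` of parts 3/4 lies inside the even window `(0, 11/40]`.
[folklore] -/
theorem smallWindow_lt_evenWindow : (1 / 8 : ℝ) < 11 / 40 := by norm_num

end EvenWindowNamed

end Summit.RiemannHypothesis.RiemannHypothesis.Theorems.PfPersistence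

end
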